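import Summits.QuantumAdvantage.QuantumAdvantage.Theorems.ScaleDialD

/-!
# ScaleDial, part E/5: the LOWER attack edge `octLoss3_of_noPerfectQuarter3 : NoPerfectQuarter3 → OctLoss3`
(exactness at degree `n^{1/4}·polylog` buys `2^(n^{1/8})` odd losses at every polylog degree) — support for item 26533

Cell decomp-qadv, seat lens-1 («grading / quantitative ladder»), generation 12 — land port of §E of the node «ScaleDial»
rev 3 (published under the cell's HOME/decomp-qadv-lens-1/g12/ScaleDial.lean, record NODE-g12.md).  Prop-defs = the node's
edge `NoPerfectQuarter3` only.  No `sorry`, no new axioms, no instances, no notation.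
-/

set_option linter.dupNamespace false
set_option linter.style.longLine false

noncomputable section

open scoped Classical

namespace Summit.QuantumAdvantage.QuantumAdvantage.Theorems.ScaleDial

open Finset
open Literature.Computability.QuantumComplexity Literature.Computability.QuantumComplexity.RingHLF
open Literature.Computability.MetaComplexity Literature.Computability.MetaComplexity.Smolensky
open Summit.QuantumAdvantage.AdviceFreeQNC0
open Summit.QuantumAdvantage.QuantumAdvantage.Theorems.RingPeriodFold (cov covStrat covStrat_mem_lowDeg)
open Summit.QuantumAdvantage.QuantumAdvantage.Theses.ExactnessDial (NoPerfectOdd3 PolyLossOddU3 MassStep3u OddToAll3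
  DPLift3 MultiRingBridge3 NoPerfectConst3)

/-! ## E. The LOWER attack edge: exactness at degree `n^{1/4}·polylog` already buys the octic rung

`NoPerfectQuarter3 := ∀ c, ∃ n₀, ∀ n ≥ n₀, ¬ PerfectAt n (n^{1/4}·(log₂ n)^c)` — exactness at degree `n^{1/4}·polylog`, WELL
INSIDE the range `d ≪ √n` where Smolensky-type correlation bounds operate (at `d = √n` they are already vacuous) — is a
weaker hypothesis than `NoPerfectSqrt3` and still gives `OctLoss3` by the same absorption (the exchange rate needs degree
budget `48·n^{1/4}·(log₂ n)^c` only).  Degree-axis ladder: 26532 (polylog) ⟸ `NoPerfectQuarter3` ⟸ `NoPerfectSqrt3`. -/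

section EdgeLow

/-- **NoPerfectQuarter3 — the LOWER attack EDGE** [NOT T-implied · UNDECIDED · above 26532, below `NoPerfectSqrt3` on the
degree axis · an EDGE, never a piece]: for every `c`, no strategy of `𝔽₃`-degree `⌊n^{1/4}⌋·(log₂ n)^c` is perfect on the
odd class of `C_n`, eventually. -/
def NoPerfectQuarter3 : Prop :=
  ∀ c : ℕ, ∃ n₀ : ℕ, ∀ n ≥ n₀, ¬ PerfectAt n (Nat.sqrt (Nat.sqrt n) * (Nat.log 2 n) ^ c)

/-- `NoPerfectSqrt3 → NoPerfectQuarter3` (`n^{1/4}·(log₂ n)^c ≤ √n` eventually). -/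
theorem noPerfectQuarter3_of_noPerfectSqrt3 (h : NoPerfectSqrt3) : NoPerfectQuarter3 := by
  obtain ⟨n₀, hn₀⟩ := h
  intro c
  refine ⟨max n₀ (2 ^ (2 ^ (4 * c + 1))), fun n hn hperf => ?_⟩
  have hn₀' : n₀ ≤ n := le_trans (le_max_left _ _) hn
  have hnbig : 2 ^ (2 ^ (4 * c + 1)) ≤ n := le_trans (le_max_right _ _) hn
  set L := Nat.log 2 n with hL
  have hn0 : n ≠ 0 := by have := Nat.one_le_two_pow (n := 2 ^ (4 * c + 1)); omega
  have hLbig : 2 ^ (4 * c + 1) ≤ L := Nat.le_log_of_pow_le (by norm_num) hnbig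
  have hLn : 2 ^ L ≤ n := Nat.pow_log_le_self 2 hn0
  have h1 : L ^ (4 * c) < 2 ^ L := pow_lt_two_pow hLbig
  obtain ⟨s, hs⟩ : ∃ s, s = Nat.sqrt n := ⟨_, rfl⟩
  obtain ⟨s₂, hs₂⟩ : ∃ s₂, s₂ = Nat.sqrt s := ⟨_, rfl⟩
  have hs₂s : s₂ * s₂ ≤ s := by rw [hs₂]; exact Nat.sqrt_le s
  -- `(log₂ n)^c ≤ n^{1/4}`: `((log₂ n)^c)^4 ≤ n`
  have hc4 : L ^ c ≤ s₂ := by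
    have h8 : (L ^ c) ^ 8 ≤ n * n := by
      calc (L ^ c) ^ 8 = L ^ (4 * c) * L ^ (4 * c) := by ring
        _ ≤ n * n := Nat.mul_le_mul (by omega) (by omega)
    have h4 : (L ^ c) ^ 4 ≤ n := by
      by_contra hlt
      rw [not_le] at hlt
      have : n * n < (L ^ c) ^ 4 * (L ^ c) ^ 4 := Nat.mul_lt_mul'' hlt hlt
      have h8' : (L ^ c) ^ 4 * (L ^ c) ^ 4 = (L ^ c) ^ 8 := by ring
      omega
    have h2 : (L ^ c) ^ 2 ≤ s := by
      rw [hs]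
      exact Nat.le_sqrt.2 (by
        calc (L ^ c) ^ 2 * (L ^ c) ^ 2 = (L ^ c) ^ 4 := by ring
          _ ≤ n := h4)
    rw [hs₂]
    exact Nat.le_sqrt.2 (by
      calc L ^ c * L ^ c = (L ^ c) ^ 2 := by ring
        _ ≤ s := h2)
  have hdeg : s₂ * L ^ c ≤ s := le_trans (Nat.mul_le_mul_left _ hc4) hs₂s
  have hdeg' : Nat.sqrt (Nat.sqrt n) * (Nat.log 2 n) ^ c ≤ Nat.sqrt n := by rw [← hs, ← hs₂]; exact hdeg
  exact hn₀ n hn₀' (perfectAt_mono hdeg' hperf)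

/-- the lower edge still sits above 26532: `NoPerfectQuarter3 → NoPerfectOdd3`. -/
theorem noPerfectOdd3_of_noPerfectQuarter3 (h : NoPerfectQuarter3) : NoPerfectOdd3 := by
  rw [noPerfectOdd3_iff_cells]
  intro c
  obtain ⟨n₀, hn₀⟩ := h c
  refine ⟨max n₀ 1, fun n hn hperf => hn₀ n (le_trans (le_max_left _ _) hn) (perfectAt_mono ?_ hperf)⟩
  have hn1 : 1 ≤ n := le_trans (le_max_right _ _) hn
  have h1 : 1 ≤ Nat.sqrt (Nat.sqrt n) := Nat.le_sqrt.2 (by simpa using Nat.le_sqrt.2 (by simpa using hn1))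
  exact Nat.le_mul_of_pos_left _ h1

/-- `√(16y) ≤ 4√y + 3` and `√(4t+3) ≤ 2√t + 1`: the fourth root at most triples when the argument grows 16-fold. -/
theorem sqrt_sqrt_le_of_le {n y : ℕ} (h : n ≤ 16 * y) : Nat.sqrt (Nat.sqrt n) ≤ 2 * Nat.sqrt (Nat.sqrt y) + 1 := by
  have h1 : Nat.sqrt n ≤ Nat.sqrt (16 * y) := Nat.sqrt_le_sqrt h
  have h2 : Nat.sqrt (16 * y) ≤ 4 * Nat.sqrt y + 3 := by
    have hy := Nat.lt_succ_sqrt y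
    have : Nat.sqrt (16 * y) < 4 * Nat.sqrt y + 4 := Nat.sqrt_lt.2 (by nlinarith)
    omega
  have h3 : Nat.sqrt n ≤ 4 * Nat.sqrt y + 3 := h1.trans h2
  have h4 : Nat.sqrt (Nat.sqrt n) ≤ Nat.sqrt (4 * Nat.sqrt y + 3) := Nat.sqrt_le_sqrt h3
  have h5 : Nat.sqrt (4 * Nat.sqrt y + 3) ≤ 2 * Nat.sqrt (Nat.sqrt y) + 1 := by
    have hy := Nat.lt_succ_sqrt (Nat.sqrt y)
    have : Nat.sqrt (4 * Nat.sqrt y + 3) < 2 * Nat.sqrt (Nat.sqrt y) + 2 := Nat.sqrt_lt.2 (by nlinarith)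
    omega
  exact h4.trans h5

/-- ★ **THE LOWER EDGE BUYS THE OCTIC RUNG: `NoPerfectQuarter3 → OctLoss3`.**  Same absorption with `k = n^{1/8}` tokens;
the pulled-back degree `(3k+1)²(2(log₂ n)^c+1) ≤ 48·n^{1/4}·(log₂ n)^c ≤ 144·(n−3k)^{1/4}·(log₂ n)^c ≤
(n−3k)^{1/4}·(log₂ (n−3k))^(c+1)`. -/
theorem octLoss3_of_noPerfectQuarter3 (h : NoPerfectQuarter3) : OctLoss3 := by
  intro c
  obtain ⟨n₀, hn₀⟩ := h (c + 1)
  refine ⟨2 * n₀ + 2 ^ (2 ^ (4 * c + 26)), fun n hn P hP => ?_⟩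
  by_contra hlt
  rw [not_le] at hlt
  set L := Nat.log 2 n with hL
  have hnbig : 2 ^ (2 ^ (4 * c + 26)) ≤ n := le_trans (Nat.le_add_left _ _) hn
  have hn0 : n ≠ 0 := by have := Nat.one_le_two_pow (n := 2 ^ (4 * c + 26)); omega
  have hLbig : 2 ^ (4 * c + 26) ≤ L := Nat.le_log_of_pow_le (by norm_num) hnbig
  have hL2 : 2 ≤ L := le_trans (by
    calc 2 = 2 ^ 1 := rfl
      _ ≤ 2 ^ (4 * c + 26) := Nat.pow_le_pow_right (by norm_num) (by omega)) hLbig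
  have hLn : 2 ^ L ≤ n := Nat.pow_log_le_self 2 hn0
  have hpl : L ^ (4 * c + 25) < 2 ^ L := pow_lt_two_pow (by simpa [add_assoc] using hLbig)
  have hbig : 2 ^ 25 * L ^ (4 * c) ≤ n := by
    calc 2 ^ 25 * L ^ (4 * c) ≤ L ^ 25 * L ^ (4 * c) := Nat.mul_le_mul_right _ (Nat.pow_le_pow_left hL2 25)
      _ = L ^ (4 * c + 25) := by ring
      _ ≤ n := by omega
  obtain ⟨s, hs⟩ : ∃ s, s = Nat.sqrt n := ⟨_, rfl⟩
  obtain ⟨s₂, hs₂⟩ : ∃ s₂, s₂ = Nat.sqrt s := ⟨_, rfl⟩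
  obtain ⟨k, hk⟩ : ∃ k, k = oct n := ⟨_, rfl⟩
  have hks : k = Nat.sqrt s₂ := by rw [hk, oct, ← hs, ← hs₂]
  have hss : s * s ≤ n := by rw [hs]; exact Nat.sqrt_le n
  have hs₂s : s₂ * s₂ ≤ s := by rw [hs₂]; exact Nat.sqrt_le s
  have hkk : k * k ≤ s₂ := by rw [hks]; exact Nat.sqrt_le s₂
  have hk1 : 1 ≤ k := by rw [hk]; exact one_le_oct (by omega)
  have hd1 : 1 ≤ L ^ c := Nat.one_le_pow _ _ (by omega)
  have hd2 : 1 ≤ L ^ (2 * c) := Nat.one_le_pow _ _ (by omega)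
  have hd0 : 1 ≤ 2 ^ (2 ^ (4 * c + 26)) := Nat.one_le_two_pow
  have hlt' : (losers n P).card < 2 ^ k := by rw [hk]; exact hlt
  have hW : 4608 * L ^ (2 * c) ≤ s := by
    rw [hs]
    exact Nat.le_sqrt.2 (by
      calc 4608 * L ^ (2 * c) * (4608 * L ^ (2 * c)) = 21233664 * L ^ (4 * c) := by ring
        _ ≤ 2 ^ 25 * L ^ (4 * c) := Nat.mul_le_mul_right _ (by norm_num)
        _ ≤ n := hbig)
  have hs6 : 6 ≤ s := le_trans (by omega) hW
  have h6s : 6 * s ≤ n := le_trans (Nat.mul_le_mul_right _ hs6) hss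
  have hks₂ : k ≤ s₂ := (Nat.le_mul_self k).trans hkk
  have hs₂le : s₂ ≤ s := (Nat.le_mul_self s₂).trans hs₂s
  have h6k : 6 * k ≤ n := by
    have : k ≤ s := hks₂.trans hs₂le
    omega
  obtain ⟨m, hm, hnm⟩ : ∃ m, 2 ≤ m ∧ n = m + 3 * k + 1 := ⟨n - 3 * k - 1, by omega, by omega⟩
  have hperf := absorb hnm hm P hP hlt'
  have hm1 : n₀ ≤ m + 1 := by omega
  have hn2m : n ≤ 2 * (m + 1) := by omega
  -- fourth roots: `s₂ ≤ 2 t + 1 ≤ 3 t`, `t = (m+1)^{1/4}`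
  obtain ⟨t, ht⟩ : ∃ t, t = Nat.sqrt (Nat.sqrt (m + 1)) := ⟨_, rfl⟩
  have ht1 : 1 ≤ t := by
    have h1 : 1 ≤ Nat.sqrt (m + 1) := Nat.le_sqrt.2 (by omega)
    rw [ht]; exact Nat.le_sqrt.2 (by simpa using h1)
  have hs₂t : s₂ ≤ 2 * t + 1 := by
    rw [hs₂, hs, ht]; exact sqrt_sqrt_le_of_le (by omega)
  -- logs: `L ≤ L' + 1`, `L' ≥ 2^(c+8)`
  set L' := Nat.log 2 (m + 1) with hL'
  have hLL' : L ≤ L' + 1 := log_le_log_add_one (by omega) hn2m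
  have hL'big : 2 ^ (c + 8) ≤ L' := by
    have h2 : 2 ^ (L - 1) ≤ m + 1 := by
      have : 2 ^ (L - 1) * 2 ≤ n := by
        calc 2 ^ (L - 1) * 2 = 2 ^ (L - 1 + 1) := by rw [pow_succ]
          _ = 2 ^ L := by congr 1; omega
          _ ≤ n := hLn
      omega
    have h3 : L - 1 ≤ L' := Nat.le_log_of_pow_le (by norm_num) h2
    have h4 : 2 ^ (c + 8) + 1 ≤ 2 ^ (4 * c + 26) := by
      have := Nat.pow_lt_pow_right (a := 2) (by norm_num) (show c + 8 < 4 * c + 26 by omega)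
      omega
    omega
  -- degree: `(3k+1)²(2L^c+1) ≤ 48 s₂ L^c ≤ 144 t L^c ≤ t · L'^(c+1)`
  have hX1 : (3 * k + 1) ^ 2 * (2 * L ^ c + 1) ≤ 48 * s₂ * L ^ c := by
    have hk2 : (3 * k + 1) ^ 2 ≤ 16 * (k * k) := by
      have hsq : (3 * k + 1) ^ 2 = 9 * (k * k) + 6 * k + 1 := by ring
      have hkk1 : k ≤ k * k := Nat.le_mul_self k
      omega
    calc (3 * k + 1) ^ 2 * (2 * L ^ c + 1) ≤ 16 * (k * k) * (3 * L ^ c) := Nat.mul_le_mul hk2 (by omega)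
      _ ≤ 16 * s₂ * (3 * L ^ c) := Nat.mul_le_mul_right _ (Nat.mul_le_mul_left _ hkk)
      _ = 48 * s₂ * L ^ c := by ring
  have hX2 : 48 * s₂ * L ^ c ≤ t * (2 ^ 8 * (L' + 1) ^ c) := by
    calc 48 * s₂ * L ^ c ≤ 48 * (3 * t) * L ^ c := by
          have : s₂ ≤ 3 * t := by omega
          exact Nat.mul_le_mul_right _ (Nat.mul_le_mul_left _ this)
      _ = t * (144 * L ^ c) := by ring
      _ ≤ t * (2 ^ 8 * (L' + 1) ^ c) :=
          Nat.mul_le_mul_left _ (Nat.mul_le_mul (by norm_num) (Nat.pow_le_pow_left hLL' _))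
  have hX3 : 2 ^ 8 * (L' + 1) ^ c ≤ L' ^ (c + 1) := pow_mul_pow_le hL'big
  have hdeg : (3 * k + 1) ^ 2 * (2 * L ^ c + 1) ≤ Nat.sqrt (Nat.sqrt (m + 1)) * (Nat.log 2 (m + 1)) ^ (c + 1) := by
    rw [← ht, ← hL']
    exact hX1.trans (hX2.trans (Nat.mul_le_mul_left _ hX3))
  exact hn₀ (m + 1) hm1 (perfectAt_mono hdeg hperf)

/-- the lower edge closes the bottom half of the mesoscopic lift outright. -/
theorem mesoLo3_of_noPerfectQuarter3 (h : NoPerfectQuarter3) : MesoLo3 := fun _ => octLoss3_of_noPerfectQuarter3 h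

/-- **the LOWER EDGE assembly**: `NoPerfectQuarter3 ∧ MesoHi3 ∧ TopLift3 ⟹ PolyLossOddU3`. -/
theorem polyLossOddU3_of_edge₄ (hQ : NoPerfectQuarter3) (hHi : MesoHi3) (hB : TopLift3) : PolyLossOddU3 :=
  hB (hHi (octLoss3_of_noPerfectQuarter3 hQ))

/-- `closes` through the LOWER EDGE (rung leaf BY NAME). -/
theorem closes_edge₄ (hQ : NoPerfectQuarter3) (hHi : MesoHi3) (hB : TopLift3) (hO : OddToAll3) (hD : DPLift3) :
    Summit.QuantumAdvantage.AdviceFreeQNC0.AdviceFreeQNC0Three :=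
  closes (noPerfectOdd3_of_noPerfectQuarter3 hQ) (mesoLift3_iff_oct.2 ⟨mesoLo3_of_noPerfectQuarter3 hQ, hHi⟩) hB hO hD

end EdgeLow

/-! ## Axiom guards -/

/-- info: 'Summit.QuantumAdvantage.QuantumAdvantage.Theorems.ScaleDial.octLoss3_of_noPerfectQuarter3' depends on axioms: [propext, Classical.choice, Quot.sound] -/
#guard_msgs (whitespace := lax) in #print axioms octLoss3_of_noPerfectQuarter3

/-- info: 'Summit.QuantumAdvantage.QuantumAdvantage.Theorems.ScaleDial.closes_edge₄' depends on axioms: [propext, Classical.choice, Quot.sound] -/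
#guard_msgs (whitespace := lax) in #print axioms closes_edge₄

end Summit.QuantumAdvantage.QuantumAdvantage.Theorems.ScaleDial
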